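import Mathlib

/-!
# TropicalLinks / InductiveStep — every valuation ring of `Frac B` contains a projective chart

Route `ResolutionOfSingularities/TropicalLinks`, crux `InductiveStep`
(stmt-ResolutionOfSingularities-17233), line `split`, brick PR1 (properness of the projective
closure, valuation form), in support of the geometric producer `stub_valuativeCharts`.

Setting: `B` is a domain which is a `k`-algebra generated by `f₁, …, fₙ` (a closed embedding
`Y = Spec B ↪ 𝔸ⁿ`), `K = Frac B`.  With homogeneous coordinates `f' := Fin.cons 1 f`
(so `f'₀ = 1`) the projective closure `Ȳ ⊆ ℙⁿ` has the `n + 1` standard affine charts, and the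
chart `h` (for `f'_h ≠ 0`) has coordinate ring the `k`-subalgebra `𝒞_h := k[f'_j / f'_h : j] ⊆ K`.

* `tropicalLinks_exists_projChart_le_valuationSubring` — **`Ȳ` is proper (valuative criterion,
  in coordinates):** every valuation subring `V` of `K` containing the constants `k` contains some
  chart ring `𝒞_h` with `f'_h ≠ 0`.  Proof: pick `h` maximising `v (f'_j)` for `v` the valuation
  of `V` (`Finset.exists_max_image`); then `f'_h ≠ 0` since `v (f'_0) = v 1 = 1 > 0`, every ratio
  `f'_j / f'_h` has valuation `≤ 1`, i.e. lies in `V`, and `𝒞_h`, being the subring generated by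
  the image of `k` and these ratios (`Algebra.adjoin_eq_ring_closure`), is contained in `V`.

The surjectivity hypothesis on `MvPolynomial.aeval f` (the closed embedding) is part of the brick's
interface but is not needed for this containment.
-/

-- single-problem summit: the doubled namespace component `ResolutionOfSingularities` is forced
set_option linter.dupNamespace false

namespace Summit.ResolutionOfSingularities.ResolutionOfSingularities.Theorems

/-- **Maximal-valuation pivot.** For a valuation subring `V` of a field `K` and a finite family
`g : Fin (n + 1) → K` with `g 0 = 1`, there is an index `h` of maximal valuation; then `g h ≠ 0`
and every ratio `g j * (g h)⁻¹` lies in `V`. [folklore] -/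
theorem tropicalLinks_exists_max_valuation_ratio_mem {K : Type} [Field K] (V : ValuationSubring K)
    {n : ℕ} (g : Fin (n + 1) → K) (hg0 : g 0 = 1) :
    ∃ h : Fin (n + 1), g h ≠ 0 ∧ ∀ j : Fin (n + 1), g j * (g h)⁻¹ ∈ V := by
  -- adapted from `exists_forall_div_mem` in
  -- `Literature/AlgebraicGeometry/Motives/HirschowitzIyerCoveringValuative.lean`
  obtain ⟨h, -, hmax⟩ :=
    Finset.exists_max_image Finset.univ (fun j => V.valuation (g j)) Finset.univ_nonempty
  have hh : g h ≠ 0 := by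
    intro hz
    have h0 := hmax 0 (Finset.mem_univ _)
    rw [hz, map_zero, hg0, map_one] at h0
    exact not_lt.2 h0 zero_lt_one
  refine ⟨h, hh, fun j => ?_⟩
  rw [← V.valuation_le_one_iff, ← div_eq_mul_inv, map_div₀]
  exact div_le_one_of_le₀ (hmax j (Finset.mem_univ _)) zero_le

/-- **The projective closure is proper (valuative criterion, chart form).** Let `B` be a domain,
a `k`-algebra generated by `f : Fin n → B`, with fraction field `K`, and put `f' := Fin.cons 1 f`
(homogeneous coordinates of the projective closure of `Spec B ↪ 𝔸ⁿ`).  For every valuation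
subring `V` of `K` containing `algebraMap k K c` for all `c : k` there is a chart index
`h : Fin (n + 1)` with `f'_h ≠ 0`, all ratios `f'_j / f'_h ∈ V`, and the chart ring
`k[f'_j / f'_h : j]` (as a subring of `K`) contained in `V`. [folklore] -/
theorem tropicalLinks_exists_projChart_le_valuationSubring :
    ∀ (k : Type) [Field k] (B : Type) [CommRing B] [IsDomain B] [Algebra k B] (K : Type) [Field K] [Algebra B K] [IsFractionRing B K] [Algebra k K] [IsScalarTower k B K] (n : ℕ) (f : Fin n → B), Function.Surjective (MvPolynomial.aeval f : MvPolynomial (Fin n) k →ₐ[k] B) → ∀ (V : ValuationSubring K), (∀ c : k, algebraMap k K c ∈ V) → ∃ h : Fin (n + 1), (Fin.cons (1 : B) f : Fin (n + 1) → B) h ≠ 0 ∧ (∀ j : Fin (n + 1), algebraMap B K ((Fin.cons (1 : B) f : Fin (n + 1) → B) j) * (algebraMap B K ((Fin.cons (1 : B) f : Fin (n + 1) → B) h))⁻¹ ∈ V) ∧ (Algebra.adjoin k (Set.range fun j : Fin (n + 1) => algebraMap B K ((Fin.cons (1 : B) f : Fin (n + 1) → B) j) * (algebraMap B K ((Fin.cons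 (1 : B) f : Fin (n + 1) → B) h))⁻¹)).toSubring ≤ V.toSubring := by
  intro k _ B _ _ _ K _ _ _ _ _ n f _ V hV
  -- the homogeneous coordinates read in `K`: `g j = f'_j`, `g 0 = 1`
  obtain ⟨h, hh, hmem⟩ := tropicalLinks_exists_max_valuation_ratio_mem V
    (fun j : Fin (n + 1) => algebraMap B K ((Fin.cons (1 : B) f : Fin (n + 1) → B) j))
    (by simp only [Fin.cons_zero, map_one])
  have hh' : (Fin.cons (1 : B) f : Fin (n + 1) → B) h ≠ 0 := fun hz =>
    hh (by simp only [hz, map_zero])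
  refine ⟨h, hh', hmem, ?_⟩
  -- the chart ring is the subring generated by the image of `k` and the ratios
  rw [Algebra.adjoin_eq_ring_closure]
  refine Subring.closure_le.2 ?_
  rintro x (⟨c, rfl⟩ | ⟨j, rfl⟩)
  · exact hV c
  · exact hmem j

end Summit.ResolutionOfSingularities.ResolutionOfSingularities.Theorems
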